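import Summits.ValiantsHypothesis.ValiantsHypothesis.Theorems.BarrierLeverAnchoredDoorHitsLowerPairsTropical
import Summits.ValiantsHypothesis.ValiantsHypothesis.Theorems.BarrierLeverAnchoredDoorHitsLowerPairsStubGenericPoint
import Summits.ValiantsHypothesis.ValiantsHypothesis.Theorems.BarrierLeverAnchoredDoorHitsLowerPairsDoorSize
import Summits.ValiantsHypothesis.ValiantsHypothesis.Theorems.BarrierLeverAnchoredDoorHitsLowerPairsBase
import Summits.ValiantsHypothesis.ValiantsHypothesis.Theorems.BarrierLeverPartitionMinorsHitByVPTwoBlockTropical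

/-!
# Support item `AnchoredDoorHitsLowerPairs` (stmt-ValiantsHypothesis-22510), line `anchored-peeling`:
# THE THIN SIDE — 𝔄_s is symbolically nonsingular on EVERY layout with rows of size `≤ s`, for ALL `h`

Helper file (`--supports stmt-ValiantsHypothesis-22510`; cell valiant-natproofs, rung V4, 𝒟-side door (c); registered line
`Cruxes/AnchoredDoorHitsLowerPairs/Lines/anchored_peeling.lean` v3; prover seat val-np-p4 gen 16). Definition-free. Closes NO item.

MAIN THEOREM (`symbolicDet_ne_zero_of_card_le`, the «product rule» of val-np-p4 g15's memo MEMO-tropical-certificates-anchored as a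
kernel theorem): for every `s ≥ 1`, EVERY `h`, every `r` and every pair of INJECTIVE families `u w : Fin r → Finset (Fin h)` with all
rows of size `≤ s` and matched emptiness (`(∃ i, u i = ∅) ↔ (∃ j, w j = ∅)` — forced: an unmatched empty row or column of the anchored
door is identically zero), the symbolic partition minor `symbolicDet s h r u w` of the anchored door 𝔄_s is a NONZERO polynomial.
Columns are ARBITRARY (no lower-set hypothesis, no `h₀`). For lower-set pairs the emptiness hypothesis is automatic
(`symbolicDet_ne_zero_of_card_le_of_lowerSets`), so on the thin side the registered stub `stub_symbolicNonvanishing` holds for every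
`s ≥ 1` from `h₀ = 0`; by `stub_genericPoint` (p575512) every such layout is an `AnchoredHit` (`anchoredHit_of_card_le`), and by the
door size (p575704's lemmas) it is hit inside `SmallCircuits ℂ (h+h) (2s+4)` once `h ≥ 9(s+1)²` (`exists_smallCircuit_of_card_le`) —
a certified class for item 19717 `PartitionMinorsHitByVP`: ALL layouts with rows of size `≤ s` and matched emptiness, every constant `s`.

PROOF. Sort rows and columns by the binary weight `λ` (`Tuple.sort`; permuting rows / columns only changes the sign), so that
`i ↦ λ(u i)` and `j ↦ λ(w j)` are strictly increasing; attach to every nonempty row `i` the anchor `(u i | {c i})` with `c i ∈ w i`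
(possible: after sorting, `u i = ∅ ↔ w i = ∅`, `empty_iff_of_sorted`) and apply the tropical specialisation of
`…AnchoredDoorHitsLowerPairsTropical` for this anchor set `K`. The specialised layout matrix is the image under `ℕ[T] → ℂ[T]` of the
matrix `E` of `tropW K`-coefficients; `E i j` has degree `≤ λ(w j)·λ(u i)` (`natDegree_coeff_pexpo_tropW_le`) with coefficient `≥ 1` at
that degree on the diagonal (`one_le_coeff_tropW_anchor` / `one_le_coeff_tropW_zero`), and for every permutation `σ ≠ 1` the STRICT
REARRANGEMENT INEQUALITY (`sum_mul_perm_lt_of_strictMono`, from Mathlib's `Monovary.sum_mul_comp_perm_lt_sum_mul_iff` and «a strictly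
monotone permutation of `Fin r` is the identity») gives `Σ_i λ(w i)λ(u (σ i)) < Σ_i λ(w i)λ(u i)`; the tropical determinant lemma in
diagonal form (`det_ne_zero_of_unique_top`) concludes.

WHAT THIS IS NOT: the thick × thick pairs (`stub_rigidPairs`, the content of the line) are untouched; no statement closes items
22510 / 19717; nothing on crux stmt-ValiantsHypothesis-14610 or on `VP` versus `VNP`.
-/

set_option linter.dupNamespace false

namespace Summit.ValiantsHypothesis.ValiantsHypothesis.Theorems.BarrierLever.AnchoredPeeling

open Finset MvPolynomial
open Literature.Barriers.ValiantsHypothesis (SmallCircuits)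
open Literature.Computability.AlgebraicComplexity (complexity)
open Summit.ValiantsHypothesis.ValiantsHypothesis.Theorems.BarrierLever.BrickCalculus (pexpo pexpo_def)
open Summit.ValiantsHypothesis.ValiantsHypothesis.Theorems.BarrierLever.AdditiveDoor
  (truncation_spec degree_partitionExpo_le)

noncomputable section

namespace ProductRule

/-! ## 1. The tropical determinant lemma (diagonal form) -/

/-- **Tropical determinant lemma, diagonal form.** Let `M` be a square matrix over `ℂ[T]` with `natDegree (M i j) ≤ ν i j`, nonzero
coefficients `[T^{ν i i}] M i i` on the diagonal, and `Σ_i ν (σ i) i < Σ_i ν i i` for every permutation `σ ≠ 1`. Then `det M ≠ 0`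
(its coefficient at `Σ_i ν i i` is the product of the diagonal top coefficients). -/
theorem det_ne_zero_of_unique_top {r : ℕ} (M : Matrix (Fin r) (Fin r) (Polynomial ℂ)) (ν : Fin r → Fin r → ℕ)
    (hdeg : ∀ i j, (M i j).natDegree ≤ ν i j) (hdiag : ∀ i, (M i i).coeff (ν i i) ≠ 0)
    (huniq : ∀ σ : Equiv.Perm (Fin r), σ ≠ 1 → ∑ i, ν (σ i) i < ∑ i, ν i i) : M.det ≠ 0 := by
  classical
  have hcoeff : M.det.coeff (∑ i, ν i i) = ∏ i, (M i i).coeff (ν i i) := by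
    rw [Matrix.det_apply, Polynomial.finsetSum_coeff, Finset.sum_eq_single (1 : Equiv.Perm (Fin r))]
    · rw [Equiv.Perm.sign_one, one_smul]
      exact TwoBlock.coeff_prod_of_natDegree_le_sum Finset.univ (fun i => M i i) (fun i => ν i i)
        (fun i _ => hdeg i i)
    · intro σ _ hσ
      rw [Polynomial.coeff_smul]
      have hlt : (∏ i, M (σ i) i).natDegree < ∑ i, ν i i :=
        lt_of_le_of_lt ((Polynomial.natDegree_prod_le _ _).trans (Finset.sum_le_sum fun i _ => hdeg (σ i) i))
          (huniq σ hσ)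
      rw [Polynomial.coeff_eq_zero_of_natDegree_lt hlt, smul_zero]
    · intro h1
      exact absurd (Finset.mem_univ _) h1
  intro hdet
  rw [hdet, Polynomial.coeff_zero] at hcoeff
  exact Finset.prod_ne_zero_iff.mpr (fun i _ => hdiag i) hcoeff.symm

/-- A strictly monotone permutation of `Fin r` is the identity. -/
theorem perm_eq_one_of_strictMono {r : ℕ} (σ : Equiv.Perm (Fin r)) (hσ : StrictMono σ) : σ = 1 := by
  have he : ((StrictMono.orderIsoOfSurjective σ hσ σ.surjective : Fin r ≃o Fin r) : Fin r → Fin r) = σ :=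
    StrictMono.coe_orderIsoOfSurjective σ hσ σ.surjective
  have hs : StrictMono.orderIsoOfSurjective σ hσ σ.surjective = OrderIso.refl _ := Subsingleton.elim _ _
  rw [hs] at he
  ext i
  have := congrFun he i
  simp only [OrderIso.refl_apply] at this
  rw [← this]; rfl

/-- **Strict rearrangement for sorted keys.** If `f, g : Fin r → ℕ` are strictly monotone then `Σ_i f i · g (σ i) < Σ_i f i · g i`
for every permutation `σ ≠ 1` (Mathlib's `Monovary.sum_mul_comp_perm_lt_sum_mul_iff` plus `perm_eq_one_of_strictMono`). -/
theorem sum_mul_perm_lt_of_strictMono {r : ℕ} (f g : Fin r → ℕ) (hf : StrictMono f) (hg : StrictMono g)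
    (σ : Equiv.Perm (Fin r)) (hσ : σ ≠ 1) : ∑ i, f i * g (σ i) < ∑ i, f i * g i := by
  have hfg : Monovary f g := fun i j hij => (hf.le_iff_le).mpr ((hg.lt_iff_lt).mp hij).le
  refine (Monovary.sum_mul_comp_perm_lt_sum_mul_iff hfg).mpr (fun hmono => hσ ?_)
  refine perm_eq_one_of_strictMono σ (fun i j hij => ?_)
  by_contra hle
  push Not at hle
  have hne : σ j ≠ σ i := fun heq => by
    rw [σ.injective heq] at hij
    exact lt_irrefl _ hij
  have h1 : f j ≤ f i := hmono (hg (lt_of_le_of_ne hle hne))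
  exact absurd ((hf.le_iff_le).mp h1) (not_le.mpr hij)


/-! ## 2. Sorting bookkeeping -/

variable {h : ℕ}

/-- Permuting the ROWS of a layout only changes the sign of the symbolic minor. -/
theorem symbolicDet_ne_zero_of_perm_rows (s h r : ℕ) (u w : Fin r → Finset (Fin h)) (ρ : Equiv.Perm (Fin r))
    (hne : symbolicDet s h r (u ∘ ρ) w ≠ 0) : symbolicDet s h r u w ≠ 0 := by
  intro h0
  apply hne
  have h1 : symbolicDet s h r (u ∘ ρ) w =
      ((Matrix.of fun i j : Fin r => coeff (pexpo (u i) (w j)) (symbolicWitness s h)).submatrix ρ id).det := rfl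
  have h2 : (Matrix.of fun i j : Fin r => coeff (pexpo (u i) (w j)) (symbolicWitness s h)).det = symbolicDet s h r u w :=
    rfl
  rw [h1, Matrix.det_permute, h2, h0, mul_zero]

/-- If `f` is strictly increasing, `g` is monotone, `f i = 0` and `g` vanishes somewhere, then `g i = 0` (`i` is the bottom index). -/
theorem eq_zero_of_sorted {r : ℕ} (f g : Fin r → ℕ) (hf : StrictMono f) (hg : Monotone g) (i : Fin r) (hfi : f i = 0)
    (hg0 : ∃ j, g j = 0) : g i = 0 := by
  obtain ⟨j, hj⟩ := hg0
  have hij : i ≤ j := by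
    by_contra hlt
    push Not at hlt
    have := hf hlt
    omega
  have := hg hij
  omega

/-- After sorting both sides by `λ`, matched emptiness holds index by index. -/
theorem empty_iff_of_sorted {r : ℕ} (u w : Fin r → Finset (Fin h)) (hu : StrictMono (fun i => wt (u i)))
    (hw : StrictMono (fun j => wt (w j))) (hex : (∃ i, u i = ∅) ↔ (∃ j, w j = ∅)) (i : Fin r) :
    u i = ∅ ↔ w i = ∅ := by
  constructor
  · intro hi
    have h0 : ∃ j, (fun j => wt (w j)) j = 0 := by
      obtain ⟨j, hj⟩ := hex.mp ⟨i, hi⟩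
      exact ⟨j, (wt_eq_zero_iff _).mpr hj⟩
    exact (wt_eq_zero_iff _).mp
      (eq_zero_of_sorted (fun i => wt (u i)) (fun j => wt (w j)) hu hw.monotone i ((wt_eq_zero_iff _).mpr hi) h0)
  · intro hi
    have h0 : ∃ j, (fun j => wt (u j)) j = 0 := by
      obtain ⟨j, hj⟩ := hex.mpr ⟨i, hi⟩
      exact ⟨j, (wt_eq_zero_iff _).mpr hj⟩
    exact (wt_eq_zero_iff _).mp
      (eq_zero_of_sorted (fun j => wt (w j)) (fun i => wt (u i)) hw hu.monotone i ((wt_eq_zero_iff _).mpr hi) h0)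

/-! ## 3. The core theorem (sorted form) -/

/-- **CORE (sorted form).** Rows of size `≤ s`, both sides strictly sorted by `λ`, emptiness matched along the diagonal, and a
choice `c i ∈ w i` for every nonempty row: then `symbolicDet s h r u w ≠ 0`. -/
theorem symbolicDet_ne_zero_sorted (s h r : ℕ) (hs : 1 ≤ s) (u w : Fin r → Finset (Fin h)) (c : Fin r → Fin h)
    (hthin : ∀ i, (u i).card ≤ s) (hu : StrictMono (fun i => wt (u i))) (hw : StrictMono (fun j => wt (w j)))
    (hempty : ∀ i, u i = ∅ ↔ w i = ∅) (hc : ∀ i, (u i).Nonempty → c i ∈ w i) :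
    symbolicDet s h r u w ≠ 0 := by
  classical
  -- the anchor set
  set K : Finset (Finset (Fin h) × Finset (Fin h)) :=
    (Finset.univ.filter fun i : Fin r => (u i).Nonempty).image (fun i => (u i, ({c i} : Finset (Fin h)))) with hK_def
  have hK : K ⊆ anchors s h := by
    intro α hα
    rw [hK_def, Finset.mem_image] at hα
    obtain ⟨i, hi, rfl⟩ := hα
    rw [Finset.mem_filter] at hi
    rw [anchors, Finset.mem_filter]
    refine ⟨Finset.mem_univ _, Finset.card_pos.mpr hi.2, hthin i, ?_, ?_⟩
    · rw [Finset.card_singleton]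
    · rw [Finset.card_singleton]; exact hs
  have hKmem : ∀ i, (u i).Nonempty → (u i, ({c i} : Finset (Fin h))) ∈ K := fun i hi => by
    rw [hK_def, Finset.mem_image]
    exact ⟨i, Finset.mem_filter.mpr ⟨Finset.mem_univ _, hi⟩, rfl⟩
  -- the specialisation and the specialised entries
  set φ : MvPolynomial (Param h) ℂ →+* Polynomial ℂ := (aeval (tropSpec K)).toRingHom with hφ_def
  have hentry : ∀ i j, φ (coeff (pexpo (u i) (w j)) (symbolicWitness s h)) =
      Polynomial.map (Nat.castRingHom ℂ) (coeff (pexpo (u i) (w j)) (tropW K)) := by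
    intro i j
    rw [← coeff_map, hφ_def, map_tropSpec_symbolicWitness s h K hK, ← map_natCast_tropW, coeff_map,
      Polynomial.coe_mapRingHom]
  have hdet : φ (symbolicDet s h r u w) =
      (Matrix.of fun i j : Fin r => Polynomial.map (Nat.castRingHom ℂ) (coeff (pexpo (u i) (w j)) (tropW K))).det := by
    have h2 : symbolicDet s h r u w =
        (Matrix.of fun i j : Fin r => coeff (pexpo (u i) (w j)) (symbolicWitness s h)).det := rfl
    rw [h2, RingHom.map_det]
    congr 1
    ext i j
    rw [RingHom.mapMatrix_apply, Matrix.map_apply, Matrix.of_apply, Matrix.of_apply, hentry]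
  intro h0
  rw [h0, map_zero] at hdet
  refine det_ne_zero_of_unique_top _ (fun i j => wt (w j) * wt (u i)) (fun i j => ?_) (fun i => ?_)
    (fun σ hσ => sum_mul_perm_lt_of_strictMono (fun j => wt (w j)) (fun i => wt (u i)) hw hu σ hσ) hdet.symm
  · -- entrywise degree bound
    rw [Matrix.of_apply, mul_comm]
    exact Polynomial.natDegree_map_le.trans (natDegree_coeff_pexpo_tropW_le K (u i) (w j))
  · -- diagonal top coefficients
    rw [Matrix.of_apply, Polynomial.coeff_map, mul_comm, Nat.coe_castRingHom, Nat.cast_ne_zero]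
    by_cases hi : (u i).Nonempty
    · have := one_le_coeff_tropW_anchor K (u i) (w i) (c i) (hKmem i hi) (hc i hi)
      omega
    · have hui : u i = ∅ := Finset.not_nonempty_iff_eq_empty.mp hi
      have hwi : w i = ∅ := (hempty i).mp hui
      rw [hui, hwi, pexpo_empty_empty, (wt_eq_zero_iff _).mpr rfl, zero_mul]
      have := one_le_coeff_tropW_zero K
      omega

/-! ## 4. The thin-side theorem -/

/-- The degenerate case `h = 0`: only `r ≤ 1` is possible and the minor is `1`. -/
theorem symbolicDet_ne_zero_of_height_zero (s r : ℕ) (u w : Fin r → Finset (Fin 0)) (hu : Function.Injective u) :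
    symbolicDet s 0 r u w ≠ 0 := by
  have hall : ∀ (v : Fin r → Finset (Fin 0)) (i : Fin r), v i = ∅ := fun v i =>
    Finset.eq_empty_of_forall_notMem (fun a _ => a.elim0)
  have hr : r ≤ 1 := by
    by_contra hr
    push Not at hr
    have h01 : u ⟨0, by omega⟩ = u ⟨1, by omega⟩ := by rw [hall u, hall u]
    have := hu h01
    simp only [Fin.mk.injEq] at this
    omega
  rcases Nat.le_one_iff_eq_zero_or_eq_one.mp hr with rfl | rfl
  · rw [symbolicDet, Matrix.det_isEmpty]; exact one_ne_zero
  · rw [symbolicDet, Matrix.det_unique, Matrix.of_apply, hall u, hall w, Finset.sum_empty, Finset.sum_empty,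
      add_zero (0 : Fin (0 + 0) →₀ ℕ), ← constantCoeff_eq, constantCoeff_symbolicWitness]
    exact one_ne_zero

/-- **THE THIN-SIDE THEOREM (rows).** For every `s ≥ 1`, EVERY `h`, every `r`, and injective families `u, w` with all rows of size
`≤ s`, columns arbitrary, and matched emptiness: the symbolic partition minor of the anchored door 𝔄_s is nonzero. -/
theorem symbolicDet_ne_zero_of_card_le (s h r : ℕ) (hs : 1 ≤ s) (u w : Fin r → Finset (Fin h))
    (hu : Function.Injective u) (hw : Function.Injective w) (hthin : ∀ i, (u i).card ≤ s)
    (hempty : (∃ i, u i = ∅) ↔ (∃ j, w j = ∅)) : symbolicDet s h r u w ≠ 0 := by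
  classical
  rcases Nat.eq_zero_or_pos h with rfl | hpos
  · exact symbolicDet_ne_zero_of_height_zero s r u w hu
  -- sort rows and columns by `λ`
  set ρ : Equiv.Perm (Fin r) := Tuple.sort (fun i => wt (u i)) with hρ
  set π : Equiv.Perm (Fin r) := Tuple.sort (fun j => wt (w j)) with hπ
  have hu' : StrictMono (fun i => wt ((u ∘ ρ) i)) :=
    (Tuple.monotone_sort (fun i => wt (u i))).strictMono_of_injective
      ((wt_injective.comp hu).comp ρ.injective)
  have hw' : StrictMono (fun j => wt ((w ∘ π) j)) :=
    (Tuple.monotone_sort (fun j => wt (w j))).strictMono_of_injective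
      ((wt_injective.comp hw).comp π.injective)
  have hex' : (∃ i, (u ∘ ρ) i = ∅) ↔ (∃ j, (w ∘ π) j = ∅) := by
    constructor
    · rintro ⟨i, hi⟩
      obtain ⟨j, hj⟩ := hempty.mp ⟨ρ i, hi⟩
      exact ⟨π.symm j, by simp only [Function.comp_apply, Equiv.apply_symm_apply]; exact hj⟩
    · rintro ⟨j, hj⟩
      obtain ⟨i, hi⟩ := hempty.mpr ⟨π j, hj⟩
      exact ⟨ρ.symm i, by simp only [Function.comp_apply, Equiv.apply_symm_apply]; exact hi⟩
  have hempty' := empty_iff_of_sorted (u ∘ ρ) (w ∘ π) hu' hw' hex'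
  -- a column vertex for every nonempty row
  let c : Fin r → Fin h := fun i => if hx : ((w ∘ π) i).Nonempty then ((w ∘ π) i).min' hx else ⟨0, hpos⟩
  have hc : ∀ i, ((u ∘ ρ) i).Nonempty → c i ∈ (w ∘ π) i := by
    intro i hi
    have hx : ((w ∘ π) i).Nonempty := by
      rw [Finset.nonempty_iff_ne_empty]
      exact fun hw0 => (Finset.nonempty_iff_ne_empty.mp hi) ((hempty' i).mpr hw0)
    simp only [c, dif_pos hx]
    exact Finset.min'_mem _ _
  have hsorted := symbolicDet_ne_zero_sorted s h r hs (u ∘ ρ) (w ∘ π) c (fun i => hthin (ρ i)) hu' hw' hempty' hc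
  exact symbolicDet_ne_zero_of_perm_rows s h r u w ρ (symbolicDet_ne_zero_of_perm s h r (u ∘ ρ) w π hsorted)

/-- For lower-set layouts the emptiness hypothesis is automatic. -/
theorem empty_iff_of_lowerSets {r : ℕ} (u w : Fin r → Finset (Fin h)) (hlu : IsLowerSet (Set.range u))
    (hlw : IsLowerSet (Set.range w)) : (∃ i, u i = ∅) ↔ (∃ j, w j = ∅) := by
  constructor
  · rintro ⟨i, _⟩
    obtain ⟨j, hj⟩ : (∅ : Finset (Fin h)) ∈ Set.range w := hlw (Finset.empty_subset (w i)) ⟨i, rfl⟩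
    exact ⟨j, hj⟩
  · rintro ⟨j, _⟩
    obtain ⟨i, hi⟩ : (∅ : Finset (Fin h)) ∈ Set.range u := hlu (Finset.empty_subset (u j)) ⟨j, rfl⟩
    exact ⟨i, hi⟩

/-- **Thin side of the registered stub `stub_symbolicNonvanishing`:** for every `s ≥ 1` and EVERY `h` (no `h₀`), every injective
simplicial-complex pair whose row complex has dimension `≤ s − 1` has nonzero symbolic minor. -/
theorem symbolicDet_ne_zero_of_card_le_of_lowerSets (s h r : ℕ) (hs : 1 ≤ s) (u w : Fin r → Finset (Fin h))
    (hu : Function.Injective u) (hw : Function.Injective w) (hlu : IsLowerSet (Set.range u))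
    (hlw : IsLowerSet (Set.range w)) (hthin : ∀ i, (u i).card ≤ s) : symbolicDet s h r u w ≠ 0 :=
  symbolicDet_ne_zero_of_card_le s h r hs u w hu hw hthin (empty_iff_of_lowerSets u w hlu hlw)

/-- **Every thin-row layout is an anchored hit** (via the landed stub `stub_genericPoint`, p575512). -/
theorem anchoredHit_of_card_le (s h r : ℕ) (hs : 1 ≤ s) (u w : Fin r → Finset (Fin h))
    (hu : Function.Injective u) (hw : Function.Injective w) (hthin : ∀ i, (u i).card ≤ s)
    (hempty : (∃ i, u i = ∅) ↔ (∃ j, w j = ∅)) : AnchoredHit s h r u w :=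
  stub_genericPoint s h r u w (symbolicDet_ne_zero_of_card_le s h r hs u w hu hw hthin hempty)

/-- **A certified class for item 19717.** For every `s ≥ 1` and every `h ≥ 9(s+1)²`: every injective layout with all rows of size
`≤ s` (columns arbitrary) and matched emptiness has a nonzero partition minor at some member of `SmallCircuits ℂ (h+h) (2s+4)`
(the truncation of a member of 𝔄_s; size bookkeeping of `…AnchoredDoorHitsLowerPairsDoorSize`). -/
theorem exists_smallCircuit_of_card_le (s h : ℕ) (hs : 1 ≤ s) (hh : 9 * (s + 1) ^ 2 ≤ h) (r : ℕ)
    (u w : Fin r → Finset (Fin h)) (hu : Function.Injective u) (hw : Function.Injective w)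
    (hthin : ∀ i, (u i).card ≤ s) (hempty : (∃ i, u i = ∅) ↔ (∃ j, w j = ∅)) :
    ∃ f ∈ SmallCircuits ℂ (h + h) (2 * s + 4),
      (Matrix.of fun i j : Fin r => MvPolynomial.coeff
        (∑ a ∈ u i, Finsupp.single (Fin.castAdd h a) 1 + ∑ c ∈ w j, Finsupp.single (Fin.natAdd h c) 1) f).det ≠ 0 := by
  obtain ⟨θ, φ, ψ, hdet⟩ := anchoredHit_of_card_le s h r hs u w hu hw hthin hempty
  have h1 : 1 ≤ h := le_trans (Nat.one_le_iff_ne_zero.mpr (by positivity)) hh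
  obtain ⟨hdeg, hcoeff, hsize⟩ := truncation_spec (anchoredWitness s h θ φ ψ) (h + h)
  refine ⟨∑ e ∈ Finset.range (h + h + 1), homogeneousComponent e (anchoredWitness s h θ φ ψ), ⟨hdeg, ?_⟩, ?_⟩
  · calc _ ≤ (h + h + 2) ^ 2 * complexity (anchoredWitness s h θ φ ψ) + (h + h + 1) := hsize
      _ ≤ (h + h + 2) ^ 2 * (14 * (s + 1) ^ 2 * h ^ (2 * s + 1)) + (h + h + 1) := by
          gcongr; exact complexity_anchoredWitness_le s h h1 θ φ ψ
      _ ≤ (h + h) ^ (2 * s + 4) := doorSize_arith s h hh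
  · have hmat : (Matrix.of fun i j : Fin r => MvPolynomial.coeff
        (∑ a ∈ u i, Finsupp.single (Fin.castAdd h a) 1 +
          ∑ c ∈ w j, Finsupp.single (Fin.natAdd h c) 1)
        (∑ e ∈ Finset.range (h + h + 1), homogeneousComponent e (anchoredWitness s h θ φ ψ))) =
        Matrix.of fun i j : Fin r => MvPolynomial.coeff
          (∑ a ∈ u i, Finsupp.single (Fin.castAdd h a) 1 +
            ∑ c ∈ w j, Finsupp.single (Fin.natAdd h c) 1) (anchoredWitness s h θ φ ψ) := by
      ext i j
      rw [Matrix.of_apply, Matrix.of_apply, hcoeff _ (degree_partitionExpo_le _ _)]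
    rw [hmat]
    exact hdet

end ProductRule

end

end Summit.ValiantsHypothesis.ValiantsHypothesis.Theorems.BarrierLever.AnchoredPeeling
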